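import Summits.CriticalPhenomena.SAWScalingLimit.Theorems.SAWTotalPositivityCriticalBubbleBoundKestenCutCycle

/-!
# Line `kesten-product-renewal-dictionary` (crux stmt-CriticalPhenomena-7117): the two-bridge cut, II —
the two bridges `W₁`, `W₂` of a rooted polygon

Proof file (lead seat c1). For `ω ∈ Zd.sawFun 2 n e₀`, `n ≥ 2`: the two walks `fstWalk n ω` (`W₁`, `ℓ + 1`
steps) and `sndWalk n ω` (`W₂`, `ℓ'` steps) of `…KestenCutDefs.lean` are BRIDGES from the origin
(`fstWalk_mem_bridges`, `sndWalk_mem_bridges`; Madras–Slade 1993, Definition 1.2.4 = `Zd.bridges`) of total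
length `n + 2`, and `W₁`, `W₂ + e₁` meet only at their common endpoint `A - (B - e₀)` (`fst_eq_snd_add_iff`).
-/

noncomputable section

open Literature.Probability.LatticeModels
open Literature.Probability.RandomPlanarGeometry Literature.Probability.RandomPlanarGeometry.SAW
open scoped BigOperators
open Summit.CriticalPhenomena.SAWScalingLimit.Theorems.CriticalBubbleBound.Negative (e₀ adj_zero_e₀)

namespace Summit.CriticalPhenomena.SAWScalingLimit.Theorems.CriticalBubbleBound.Kesten.Cut

variable {n : ℕ} {ω : ℕ → Site 2}

/-! ## Walking around the polygon from the lowest vertex -/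

/-- Forward offsets. [folklore] -/
@[simp] theorem off_true (j : ℕ) : off n true j = j := rfl

/-- Backward offsets. [folklore] -/
@[simp] theorem off_false (j : ℕ) : off n false j = n + 1 - j := rfl

/-- Offsets are at most a period (for `j ≤ n + 1`). [folklore] -/
theorem off_le {s : Bool} {j : ℕ} (hj : j ≤ n + 1) : off n s j ≤ n + 1 := by
  cases s
  · simp only [off_false]; omega
  · simp only [off_true]; omega

/-- `j` steps backwards in direction `s` are `n + 1 - j` steps in direction `!s`. [folklore] -/
theorem off_not {s : Bool} {j : ℕ} (hj : j ≤ n + 1) : off n (!s) (n + 1 - j) = off n s j := by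
  cases s
  · simp only [Bool.not_false, off_true, off_false]
  · simp only [Bool.not_true, off_false, off_true]; omega

/-- Same, at the level of positions. [folklore] -/
theorem pos_not {s : Bool} {j : ℕ} (hj : j ≤ n + 1) : pos n ω (!s) (n + 1 - j) = pos n ω s j := by
  rw [pos, pos, off_not hj]

/-- Shifting the index by a multiple of... : `cyc` at `baseIdx + j` only depends on `j mod (n+1)`. [folklore] -/
theorem cyc_base_add_eq_iff (hω : ω ∈ Zd.sawFun 2 n e₀) {j j' : ℕ} :
    cyc n ω (baseIdx n ω + j) = cyc n ω (baseIdx n ω + j') ↔ j % (n + 1) = j' % (n + 1) := by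
  rw [cyc_eq_iff hω]
  exact ⟨fun h => Nat.ModEq.add_left_cancel' _ h, fun h => Nat.ModEq.add_left _ h⟩

/-- Two numbers at most `N` with the same residue mod `N` are equal or are `{0, N}`. [folklore] -/
theorem eq_or_of_mod_eq {N u v : ℕ} (hu : u ≤ N) (hv : v ≤ N) (h : u % N = v % N) :
    u = v ∨ (u = 0 ∧ v = N) ∨ (u = N ∧ v = 0) := by
  rcases Nat.lt_or_eq_of_le hu with hu' | rfl
  · rcases Nat.lt_or_eq_of_le hv with hv' | rfl
    · left; rwa [Nat.mod_eq_of_lt hu', Nat.mod_eq_of_lt hv'] at h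
    · rw [Nat.mod_self, Nat.mod_eq_of_lt hu'] at h
      exact Or.inr (Or.inl ⟨h, rfl⟩)
  · rcases Nat.lt_or_eq_of_le hv with hv' | rfl
    · rw [Nat.mod_self, Nat.mod_eq_of_lt hv'] at h
      exact Or.inr (Or.inr ⟨rfl, h.symm⟩)
    · exact Or.inl rfl

/-- Positions in one direction with equal cyclic values: equal step counts, up to the full period.
[folklore] -/
theorem pos_inj (hω : ω ∈ Zd.sawFun 2 n e₀) {s : Bool} {j j' : ℕ} (hj : j ≤ n + 1) (hj' : j' ≤ n + 1)
    (h : cyc n ω (pos n ω s j) = cyc n ω (pos n ω s j')) :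
    j = j' ∨ (j = 0 ∧ j' = n + 1) ∨ (j = n + 1 ∧ j' = 0) := by
  rw [pos, pos, cyc_base_add_eq_iff hω] at h
  have h' := eq_or_of_mod_eq (off_le hj) (off_le hj') h
  cases s
  · simp only [off_false] at h'
    omega
  · simp only [off_true] at h'
    exact h'

/-- Position `0` is the base vertex. [folklore] -/
theorem cyc_pos_zero (s : Bool) : cyc n ω (pos n ω s 0) = base n ω := by
  cases s
  · rw [pos, off_false, Nat.sub_zero, cyc_add_period, cyc_baseIdx]
  · rw [pos, off_true, Nat.add_zero, cyc_baseIdx]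

/-- Consecutive positions are adjacent vertices. [folklore] -/
theorem cyc_pos_adj (hω : ω ∈ Zd.sawFun 2 n e₀) (s : Bool) {j : ℕ} (hj : j + 1 ≤ n + 1) :
    (zdGraph 2).Adj (cyc n ω (pos n ω s j)) (cyc n ω (pos n ω s (j + 1))) := by
  cases s
  · have : pos n ω false j = pos n ω false (j + 1) + 1 := by simp [pos, off]; omega
    rw [this]
    exact (cyc_adj hω _).symm
  · have : pos n ω true (j + 1) = pos n ω true j + 1 := by simp [pos, off]; omega
    rw [this]
    exact cyc_adj hω _

/-- One step in direction `dir` from `B` is `B + e₀`, one step in the other direction is `B + e₁`.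
[folklore] -/
theorem cyc_pos_one (hω : ω ∈ Zd.sawFun 2 n e₀) (hn : 2 ≤ n) :
    cyc n ω (pos n ω (dir n ω) 1) = base n ω + e₀ ∧
      cyc n ω (pos n ω (!dir n ω) 1) = base n ω + eUp := by
  have hb : pos n ω false 1 = baseIdx n ω + n := by simp [pos, off]
  have ht : pos n ω true 1 = baseIdx n ω + 1 := by simp [pos, off]
  rcases cyc_baseIdx_neighbours hω hn with ⟨h1, h2⟩ | ⟨h1, h2⟩
  · have hd : dir n ω = true := by simp [dir, h1]
    rw [hd, Bool.not_true, ht, hb]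
    exact ⟨h1, h2⟩
  · have hd : dir n ω = false := by
      simp only [dir, h1, decide_eq_false_iff_not]
      intro h
      have := congrFun h 0
      simp [e₀] at this
    rw [hd, Bool.not_false, ht, hb]
    exact ⟨h2, h1⟩

/-! ## The arc lengths -/

/-- `ℓ < n + 1`. [folklore] -/
theorem arcLen_lt : arcLen n ω < n + 1 := by
  unfold arcLen; split_ifs <;> exact Nat.mod_lt _ (Nat.succ_pos n)

/-- `ℓ ≤ n`. [folklore] -/
theorem arcLen_le : arcLen n ω ≤ n := Nat.lt_succ_iff.1 arcLen_lt

/-- After `ℓ` steps in direction `dir` one is at `A`. [folklore] -/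
theorem cyc_pos_arcLen (hω : ω ∈ Zd.sawFun 2 n e₀) :
    cyc n ω (pos n ω (dir n ω) (arcLen n ω)) = apex n ω := by
  have ha : apex n ω = cyc n ω (baseIdx n ω + (apexIdx n ω + (n + 1) - baseIdx n ω)) := by
    rw [show baseIdx n ω + (apexIdx n ω + (n + 1) - baseIdx n ω) = apexIdx n ω + (n + 1) by
      have := baseIdx_le (n := n) (ω := ω); omega, cyc_add_period, cyc_of_le apexIdx_le, apex]
  unfold arcLen
  cases hd : dir n ω
  · simp only [Bool.false_eq_true, ↓reduceIte, pos, off_false]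
    rw [ha, cyc_base_add_eq_iff hω]
    -- `(n+1) - ((b + (n+1) - a) % (n+1)) ≡ a + (n+1) - b`
    have hb := baseIdx_le (n := n) (ω := ω)
    have hal := apexIdx_le (n := n) (ω := ω)
    set t := (baseIdx n ω + (n + 1) - apexIdx n ω) % (n + 1) with htdef
    have ht : t < n + 1 := Nat.mod_lt _ (Nat.succ_pos n)
    -- add `t ≡ b + (n+1) - a` to both sides: `(n+1-t) + t = n+1 ≡ 2(n+1) = (a+(n+1)-b) + (b+(n+1)-a)`
    show (n + 1 - t) ≡ (apexIdx n ω + (n + 1) - baseIdx n ω) [MOD n + 1]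
    have h₁ : t ≡ baseIdx n ω + (n + 1) - apexIdx n ω [MOD n + 1] := Nat.mod_modEq _ _
    refine Nat.ModEq.add_right_cancel h₁ ?_
    rw [Nat.sub_add_cancel ht.le, show apexIdx n ω + (n + 1) - baseIdx n ω +
      (baseIdx n ω + (n + 1) - apexIdx n ω) = (n + 1) + (n + 1) by omega]
    simp [Nat.ModEq]
  · simp only [↓reduceIte, pos, off_true]
    rw [ha, cyc_base_add_eq_iff hω, Nat.mod_mod]

/-- `1 ≤ ℓ` (`A ≠ B`). [folklore] -/
theorem one_le_arcLen (hω : ω ∈ Zd.sawFun 2 n e₀) (hn : 2 ≤ n) : 1 ≤ arcLen n ω := by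
  by_contra h
  have h0 : arcLen n ω = 0 := by omega
  have := cyc_pos_arcLen hω
  rw [h0, cyc_pos_zero, base, apex] at this
  exact baseIdx_ne_apexIdx hω (by omega) (apply_inj hω baseIdx_le apexIdx_le this)

/-- `ℓ + ℓ' = n + 1`. [folklore] -/
theorem arcLen_add_coLen : arcLen n ω + coLen n ω = n + 1 := by
  have := arcLen_lt (n := n) (ω := ω); unfold coLen; omega

/-- `1 ≤ ℓ'`. [folklore] -/
theorem one_le_coLen : 1 ≤ coLen n ω := by
  have := arcLen_lt (n := n) (ω := ω); unfold coLen; omega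

/-- `ℓ' ≤ n`. [folklore] -/
theorem coLen_le (hω : ω ∈ Zd.sawFun 2 n e₀) (hn : 2 ≤ n) : coLen n ω ≤ n := by
  have := one_le_arcLen hω hn; unfold coLen; omega

/-- After `ℓ'` steps in the other direction one is also at `A`. [folklore] -/
theorem cyc_pos_coLen (hω : ω ∈ Zd.sawFun 2 n e₀) :
    cyc n ω (pos n ω (!dir n ω) (coLen n ω)) = apex n ω := by
  rw [coLen, pos_not arcLen_lt.le, cyc_pos_arcLen hω]

/-! ## The two walks -/

/-- `W₁` starts at the origin. [folklore] -/
theorem fstWalk_zero : fstWalk n ω 0 = 0 := rfl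

/-- `W₂` starts at the origin. [folklore] -/
theorem sndWalk_zero : sndWalk n ω 0 = 0 := rfl

/-- `W₁ k` for `1 ≤ k ≤ ℓ + 1`. [folklore] -/
theorem fstWalk_of_pos {k : ℕ} (hk : 1 ≤ k) (hk' : k ≤ arcLen n ω + 1) :
    fstWalk n ω k = cyc n ω (pos n ω (dir n ω) (k - 1)) - shiftVec n ω := by
  rw [fstWalk, if_neg (by omega), min_eq_left hk']

/-- `W₁` is frozen after `ℓ + 1`. [folklore] -/
theorem fstWalk_of_ge {k : ℕ} (hk' : arcLen n ω + 1 ≤ k) :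
    fstWalk n ω k = cyc n ω (pos n ω (dir n ω) (arcLen n ω)) - shiftVec n ω := by
  rw [fstWalk, if_neg (by omega), min_eq_right hk', Nat.add_sub_cancel]

/-- `W₂ k` for `1 ≤ k ≤ ℓ'`. [folklore] -/
theorem sndWalk_of_pos {k : ℕ} (hk : 1 ≤ k) (hk' : k ≤ coLen n ω) :
    sndWalk n ω k = cyc n ω (pos n ω (!dir n ω) k) - shiftVec n ω - eUp := by
  rw [sndWalk, if_neg (by omega), min_eq_left hk']

/-- `W₂` is frozen after `ℓ'`. [folklore] -/
theorem sndWalk_of_ge {k : ℕ} (hk' : coLen n ω ≤ k) :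
    sndWalk n ω k = cyc n ω (pos n ω (!dir n ω) (coLen n ω)) - shiftVec n ω - eUp := by
  have := one_le_coLen (n := n) (ω := ω)
  rw [sndWalk, if_neg (by omega), min_eq_right hk']

/-- The endpoint of `W₁` is `A - T`. [folklore] -/
theorem fstWalk_len (hω : ω ∈ Zd.sawFun 2 n e₀) :
    fstWalk n ω (arcLen n ω + 1) = apex n ω - shiftVec n ω := by
  rw [fstWalk_of_ge le_rfl, cyc_pos_arcLen hω]

/-- The endpoint of `W₂` is `A - T - e₁`. [folklore] -/
theorem sndWalk_len (hω : ω ∈ Zd.sawFun 2 n e₀) :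
    sndWalk n ω (coLen n ω) = apex n ω - shiftVec n ω - eUp := by
  rw [sndWalk_of_ge le_rfl, cyc_pos_coLen hω]

/-- First coordinates of translated polygon vertices are between `1` and `A₀ - B₀ + 1`. [folklore] -/
theorem cyc_sub_shiftVec_zero (k : ℕ) :
    1 ≤ (cyc n ω k - shiftVec n ω) 0 ∧ (cyc n ω k - shiftVec n ω) 0 ≤ (apex n ω - shiftVec n ω) 0 := by
  have h := base_zero_le_cyc (n := n) (ω := ω) k
  have he : e₀ 0 = 1 := rfl
  simp only [shiftVec, Pi.sub_apply, he]
  omega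

/-- `W₁` is an `(ℓ+1)`-step self-avoiding walk from the origin. [folklore] -/
theorem fstWalk_mem_saws (hω : ω ∈ Zd.sawFun 2 n e₀) (hn : 2 ≤ n) :
    fstWalk n ω ∈ Zd.saws 2 (arcLen n ω + 1) := by
  have hℓ := arcLen_le (n := n) (ω := ω)
  refine Zd.mem_saws.2 ⟨fstWalk_zero, fun i hi => ?_, fun i hi => ?_, ?_⟩
  · rw [fstWalk_of_ge hi, fstWalk_of_ge le_rfl]
  · rcases Nat.eq_zero_or_pos i with rfl | hipos
    · -- the first step `0 → e₀`
      rw [fstWalk_zero, fstWalk_of_pos le_rfl (by omega), Nat.sub_self, cyc_pos_zero, shiftVec,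
        sub_sub_cancel]
      exact adj_zero_e₀
    · rw [fstWalk_of_pos hipos hi.le, fstWalk_of_pos (by omega) hi, Zd.zdGraph_adj_sub_right,
        show i + 1 - 1 = (i - 1) + 1 by omega]
      exact cyc_pos_adj hω _ (by omega)
  · intro i hi j hj hij
    simp only [Set.mem_setOf_eq] at hi hj
    wlog hle : i ≤ j generalizing i j
    · exact (this hj hi hij.symm (le_of_lt (not_le.1 hle))).symm
    rcases Nat.eq_zero_or_pos i with rfl | hipos
    · rcases Nat.eq_zero_or_pos j with rfl | hjpos
      · rfl
      · exfalso
        rw [fstWalk_zero, fstWalk_of_pos hjpos hj] at hij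
        have h1 := (cyc_sub_shiftVec_zero (n := n) (ω := ω) (pos n ω (dir n ω) (j - 1))).1
        rw [← hij] at h1
        simp at h1
    · rw [fstWalk_of_pos hipos hi, fstWalk_of_pos (by omega) hj, sub_left_inj] at hij
      rcases pos_inj hω (by omega) (by omega) hij with h | h | h <;> omega

/-- `W₁` is a bridge. [cite: MadrasSlade1993, Definition 1.2.4] -/
theorem fstWalk_mem_bridges (hω : ω ∈ Zd.sawFun 2 n e₀) (hn : 2 ≤ n) :
    fstWalk n ω ∈ Zd.bridges 2 (arcLen n ω + 1) := by
  refine Zd.mem_bridges.2 ⟨fstWalk_mem_saws hω hn, fun i hi1 hi2 => ?_⟩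
  rw [fstWalk_zero, fstWalk_of_pos hi1 hi2, fstWalk_len hω]
  have h := cyc_sub_shiftVec_zero (n := n) (ω := ω) (pos n ω (dir n ω) (i - 1))
  exact ⟨by simp only [Pi.zero_apply]; omega, h.2⟩

/-- `W₂` is an `ℓ'`-step self-avoiding walk from the origin. [folklore] -/
theorem sndWalk_mem_saws (hω : ω ∈ Zd.sawFun 2 n e₀) (hn : 2 ≤ n) :
    sndWalk n ω ∈ Zd.saws 2 (coLen n ω) := by
  have hℓ' := coLen_le hω hn
  have h1ℓ' := one_le_coLen (n := n) (ω := ω)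
  refine Zd.mem_saws.2 ⟨sndWalk_zero, fun i hi => ?_, fun i hi => ?_, ?_⟩
  · rw [sndWalk_of_ge hi, sndWalk_of_ge le_rfl]
  · rcases Nat.eq_zero_or_pos i with rfl | hipos
    · -- the first step `0 → e₀` (`(B + e₁) - (B - e₀) - e₁ = e₀`)
      rw [sndWalk_zero, sndWalk_of_pos le_rfl h1ℓ', (cyc_pos_one hω hn).2, shiftVec,
        show base n ω + eUp - (base n ω - e₀) - eUp = e₀ by abel]
      exact adj_zero_e₀
    · rw [sndWalk_of_pos hipos hi.le, sndWalk_of_pos (by omega) hi, Zd.zdGraph_adj_sub_right,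
        Zd.zdGraph_adj_sub_right]
      exact cyc_pos_adj hω _ (by omega)
  · intro i hi j hj hij
    simp only [Set.mem_setOf_eq] at hi hj
    wlog hle : i ≤ j generalizing i j
    · exact (this hj hi hij.symm (le_of_lt (not_le.1 hle))).symm
    rcases Nat.eq_zero_or_pos i with rfl | hipos
    · rcases Nat.eq_zero_or_pos j with rfl | hjpos
      · rfl
      · exfalso
        rw [sndWalk_zero, sndWalk_of_pos hjpos hj] at hij
        have h1 := (cyc_sub_shiftVec_zero (n := n) (ω := ω) (pos n ω (!dir n ω) j)).1
        have := congrFun hij 0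
        simp only [Pi.zero_apply, Pi.sub_apply, eUp_zero, sub_zero] at this
        simp only [Pi.sub_apply] at h1
        omega
    · rw [sndWalk_of_pos hipos hi, sndWalk_of_pos (by omega) hj, sub_left_inj, sub_left_inj] at hij
      rcases pos_inj hω (by omega) (by omega) hij with h | h | h <;> omega

/-- `W₂` is a bridge. [cite: MadrasSlade1993, Definition 1.2.4] -/
theorem sndWalk_mem_bridges (hω : ω ∈ Zd.sawFun 2 n e₀) (hn : 2 ≤ n) :
    sndWalk n ω ∈ Zd.bridges 2 (coLen n ω) := by
  refine Zd.mem_bridges.2 ⟨sndWalk_mem_saws hω hn, fun i hi1 hi2 => ?_⟩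
  rw [sndWalk_zero, sndWalk_of_pos hi1 hi2, sndWalk_len hω]
  have h := cyc_sub_shiftVec_zero (n := n) (ω := ω) (pos n ω (!dir n ω) i)
  simp only [Pi.zero_apply, Pi.sub_apply, eUp_zero, sub_zero] at h ⊢
  exact ⟨by omega, h.2⟩

/-! ## The two walks meet only at the apex -/

/-- `W₁ i = W₂ j + e₁` happens only at the common endpoint. [folklore] -/
theorem fst_eq_snd_add_iff (hω : ω ∈ Zd.sawFun 2 n e₀) (hn : 2 ≤ n) {i j : ℕ}
    (hi : i ≤ arcLen n ω + 1) (hj : j ≤ coLen n ω) (h : fstWalk n ω i = sndWalk n ω j + eUp) :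
    i = arcLen n ω + 1 ∧ j = coLen n ω := by
  have hℓ := arcLen_le (n := n) (ω := ω)
  have hℓ' := coLen_le hω hn
  have hsum := arcLen_add_coLen (n := n) (ω := ω)
  rcases Nat.eq_zero_or_pos i with rfl | hipos
  · exfalso
    rcases Nat.eq_zero_or_pos j with rfl | hjpos
    · -- `0 = e₁`
      rw [fstWalk_zero, sndWalk_zero, zero_add] at h
      have := congrFun h 1
      simp at this
    · -- `0 = (vertex) - T`, impossible by the first coordinate
      rw [fstWalk_zero, sndWalk_of_pos hjpos hj, sub_add_cancel] at h
      have h1 := (cyc_sub_shiftVec_zero (n := n) (ω := ω) (pos n ω (!dir n ω) j)).1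
      rw [← h] at h1
      simp at h1
  · rcases Nat.eq_zero_or_pos j with rfl | hjpos
    · -- `(vertex) - T = e₁`: the vertex would be `B - e₀ + e₁`, lexicographically below `B`
      exfalso
      rw [fstWalk_of_pos hipos hi, sndWalk_zero, zero_add, sub_eq_iff_eq_add, shiftVec] at h
      obtain ⟨k, hk, hck⟩ := cyc_mem (n := n) (ω := ω) (pos n ω (dir n ω) (i - 1))
      rw [hck] at h
      have he : e₀ 0 = 1 := rfl
      have h0 : ω k 0 = base n ω 0 - 1 := by
        rw [h]; simp only [Pi.add_apply, Pi.sub_apply, eUp_zero, he]; ring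
      have := base_zero_le (ω := ω) hk
      omega
    · rw [fstWalk_of_pos hipos hi, sndWalk_of_pos hjpos hj, sub_add_cancel, sub_left_inj,
        ← pos_not (s := !dir n ω) (by omega), Bool.not_not] at h
      rcases pos_inj hω (by omega) (by omega) h with h' | h' | h' <;> omega


/-- **The two arcs are bridges** (registered sub-goal; explicit-binder form of `fstWalk_mem_bridges`,
`sndWalk_mem_bridges`). [cite: MadrasSlade1993, Definition 1.2.4] -/
theorem cutWalks_mem_bridges : ∀ (n : ℕ) (ω : ℕ → Site 2), ω ∈ Zd.sawFun 2 n e₀ → 2 ≤ n → fstWalk n ω ∈ Zd.bridges 2 (arcLen n ω + 1) ∧ sndWalk n ω ∈ Zd.bridges 2 (coLen n ω) :=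
  fun _ _ hω hn => ⟨fstWalk_mem_bridges hω hn, sndWalk_mem_bridges hω hn⟩

end Summit.CriticalPhenomena.SAWScalingLimit.Theorems.CriticalBubbleBound.Kesten.Cut

end
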